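import Mathlib.Analysis.SpecialFunctions.SmoothTransition
import Mathlib.Analysis.InnerProductSpace.PiL2
import Mathlib.Analysis.Calculus.ContDiff.Basic
import Mathlib.Topology.MetricSpace.Thickening
import Mathlib.Analysis.InnerProductSpace.Calculus
import HarnessLib

/-!
# Smooth cut-offs in the jet variables (topic `Analysis/PDE`)

Layer (III), step 5b (first part), of the programme to prove short-time existence for
quasilinear strictly parabolic systems on a closed manifold (hypothesis `hQL` of
`Literature.Geometry.Riemannian.ricciFlow_shortTime_existence_of_quasilinear`). The composition
estimates of `JetComposition.lean` are stated for *globally smooth, compactly supported*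
coefficient functions `G(y, J)` of the point `y` and the jet `J`, whereas the coefficients of the
quasilinear operator are smooth only on an open jet domain. Since the jets of the Picard iterates
stay uniformly close to the base jet, the coefficients may be cut off: this file provides the
smooth cut-off `jetBump ρ J = ψ(q(J)/ρ²)` in the jet (`q(J) = ‖J.1‖² + Σᵢ ‖J.2 bᵢ‖²` a smooth
substitute for `‖J‖²` on `𝒥 = W × (E' →L W)`), the compactness choice of the radius
(`exists_radius_of_isCompact`), and the global smoothness, compact support and identity region of
the cut-off extension `cutoffExt χ ρ G (y, J) = (χ y · jetBump ρ J) • G (y, J)`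
(`contDiff_cutoffExt`, `hasCompactSupport_cutoffExt`, `cutoffExt_eq`).

Everything is proved; no named fact and no `sorry` is introduced.

## References

* L. Hörmander, *The Analysis of Linear Partial Differential Operators I*, Springer 1983,
  Thm. 1.4.1 (cut-off functions). [HormanderALPDO1]
-/

noncomputable section

open Set Function Filter Topology Metric
open scoped ContDiff Topology

namespace Literature.Analysis.PDE

variable {E' : Type*} [NormedAddCommGroup E'] [InnerProductSpace ℝ E'] [FiniteDimensional ℝ E']
variable {W : Type*} [NormedAddCommGroup W] [InnerProductSpace ℝ W]
variable {V : Type*} [NormedAddCommGroup V] [NormedSpace ℝ V]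

/-! ### A smooth size function on the jet space -/

/-- **The smooth size of a jet**: `q(J) = ‖J.1‖² + Σᵢ ‖J.2 bᵢ‖²` in the standard frame `b`.
[folklore] -/
def jetQ (J : W × (E' →L[ℝ] W)) : ℝ := ‖J.1‖ ^ 2 + ∑ i, ‖J.2 (stdOrthonormalBasis ℝ E' i)‖ ^ 2

/-- `jetQ` is smooth. [folklore] -/
theorem contDiff_jetQ : ContDiff ℝ ∞ (jetQ : W × (E' →L[ℝ] W) → ℝ) := by
  refine (contDiff_fst.norm_sq ℝ).add (ContDiff.sum fun i _ ↦ ?_)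
  exact (contDiff_snd.clm_apply contDiff_const).norm_sq ℝ

/-- `jetQ` is nonnegative. [folklore] -/
theorem jetQ_nonneg (J : W × (E' →L[ℝ] W)) : 0 ≤ jetQ J := by
  unfold jetQ; positivity

/-- The operator norm through the frame: `‖D‖² ≤ n Σᵢ ‖D bᵢ‖²`. [folklore] -/
theorem opNorm_sq_le_sum (D : E' →L[ℝ] W) :
    ‖D‖ ^ 2 ≤ (Module.finrank ℝ E' : ℝ) * ∑ i, ‖D (stdOrthonormalBasis ℝ E' i)‖ ^ 2 := by
  set e := stdOrthonormalBasis ℝ E' with he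
  set S := ∑ i, ‖D (e i)‖ ^ 2 with hS
  have hS0 : 0 ≤ S := Finset.sum_nonneg fun i _ ↦ sq_nonneg _
  -- `‖D x‖ ≤ √(n S) ‖x‖`
  have hbound : ∀ x, ‖D x‖ ≤ Real.sqrt ((Module.finrank ℝ E' : ℝ) * S) * ‖x‖ := by
    intro x
    have hx : D x = ∑ i, (inner ℝ (e i) x) • D (e i) := by
      conv_lhs => rw [← e.sum_repr' x]
      rw [map_sum]; exact Finset.sum_congr rfl fun i _ ↦ by rw [map_smul]
    rw [hx]
    refine (norm_sum_le _ _).trans ?_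
    have h1 : ∑ i, ‖(inner ℝ (e i) x) • D (e i)‖ = ∑ i, |inner ℝ (e i) x| * ‖D (e i)‖ := by
      refine Finset.sum_congr rfl fun i _ ↦ ?_; rw [norm_smul, Real.norm_eq_abs]
    rw [h1]
    -- Cauchy–Schwarz in `ℝⁿ`
    have hcs := Real.sum_mul_le_sqrt_mul_sqrt Finset.univ (fun i ↦ |inner ℝ (e i) x|) (fun i ↦ ‖D (e i)‖)
    refine hcs.trans ?_
    have hpar : ∑ i, |inner ℝ (e i) x| ^ 2 = ‖x‖ ^ 2 := by
      have h := e.sum_sq_norm_inner_left x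
      simp only [Real.norm_eq_abs] at h ⊢
      simpa [sq_abs, real_inner_comm] using h
    rw [hpar, Real.sqrt_sq (norm_nonneg _), mul_comm]
    refine mul_le_mul_of_nonneg_right (Real.sqrt_le_sqrt ?_) (norm_nonneg _)
    rw [← hS]
    rcases Nat.eq_zero_or_pos (Module.finrank ℝ E') with h0 | hpos
    · have : S = 0 := by
        rw [hS]; exact Finset.sum_eq_zero fun i _ ↦ absurd i.2 (by omega)
      simp [this]
    · exact le_mul_of_one_le_left hS0 (by exact_mod_cast hpos)
  have hop : ‖D‖ ≤ Real.sqrt ((Module.finrank ℝ E' : ℝ) * S) := ContinuousLinearMap.opNorm_le_bound _ (Real.sqrt_nonneg _) hbound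
  calc ‖D‖ ^ 2 ≤ (Real.sqrt ((Module.finrank ℝ E' : ℝ) * S)) ^ 2 := pow_le_pow_left₀ (norm_nonneg _) hop 2
    _ = (Module.finrank ℝ E' : ℝ) * S := Real.sq_sqrt (by positivity)

/-- **The jet norm is controlled by the smooth size**: `‖J‖² ≤ (n + 1) q(J)`. [folklore] -/
theorem norm_sq_le_jetQ (J : W × (E' →L[ℝ] W)) : ‖J‖ ^ 2 ≤ ((Module.finrank ℝ E' : ℝ) + 1) * jetQ J := by
  have h1 : ‖J.1‖ ^ 2 ≤ jetQ J := by unfold jetQ; linarith [Finset.sum_nonneg fun i (_ : i ∈ Finset.univ) ↦ sq_nonneg ‖J.2 (stdOrthonormalBasis ℝ E' i)‖]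
  have h2 : ‖J.2‖ ^ 2 ≤ (Module.finrank ℝ E' : ℝ) * jetQ J := by
    refine (opNorm_sq_le_sum J.2).trans (mul_le_mul_of_nonneg_left ?_ (Nat.cast_nonneg _))
    unfold jetQ; linarith [sq_nonneg ‖J.1‖]
  have hq := jetQ_nonneg J
  rcases le_total ‖J.1‖ ‖J.2‖ with h | h
  · rw [Prod.norm_def, max_eq_right h]; nlinarith
  · rw [Prod.norm_def, max_eq_left h]; nlinarith

/-! ### The jet bump -/

/-- A smooth step: `ψ = 1` on `(-∞, 1]`, `ψ = 0` on `[2, ∞)`, `0 ≤ ψ ≤ 1`. [folklore] -/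
def smoothStep (t : ℝ) : ℝ := Real.smoothTransition (2 - t)

/-- `smoothStep` is smooth. [folklore] -/
theorem contDiff_smoothStep : ContDiff ℝ ∞ smoothStep :=
  Real.smoothTransition.contDiff.comp (contDiff_const.sub contDiff_id)

/-- `smoothStep = 1` below `1`. [folklore] -/
theorem smoothStep_of_le_one {t : ℝ} (ht : t ≤ 1) : smoothStep t = 1 := Real.smoothTransition.one_of_one_le (by linarith)

/-- `smoothStep = 0` above `2`. [folklore] -/
theorem smoothStep_of_two_le {t : ℝ} (ht : 2 ≤ t) : smoothStep t = 0 := Real.smoothTransition.zero_of_nonpos (by linarith)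

/-- **The jet bump of radius `ρ`**: `jetBump ρ J = ψ(q(J)/ρ²)`; `= 1` where `q(J) ≤ ρ²`, `= 0`
where `q(J) ≥ 2ρ²`. [cite: HormanderALPDO1, Thm. 1.4.1] -/
def jetBump (ρ : ℝ) (J : W × (E' →L[ℝ] W)) : ℝ := smoothStep (jetQ J / ρ ^ 2)

/-- `jetBump` is smooth. [folklore] -/
theorem contDiff_jetBump (ρ : ℝ) : ContDiff ℝ ∞ (jetBump ρ : W × (E' →L[ℝ] W) → ℝ) :=
  contDiff_smoothStep.comp (contDiff_jetQ.div_const _)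

/-- `jetBump ρ J = 1` where `q(J) ≤ ρ²`. [folklore] -/
theorem jetBump_eq_one {ρ : ℝ} (hρ : 0 < ρ) {J : W × (E' →L[ℝ] W)} (hJ : jetQ J ≤ ρ ^ 2) : jetBump ρ J = 1 :=
  smoothStep_of_le_one ((div_le_one (by positivity)).2 hJ)

/-- `jetBump ρ J = 0` where `q(J) ≥ 2ρ²`. [folklore] -/
theorem jetBump_eq_zero {ρ : ℝ} (hρ : 0 < ρ) {J : W × (E' →L[ℝ] W)} (hJ : 2 * ρ ^ 2 ≤ jetQ J) : jetBump ρ J = 0 :=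
  smoothStep_of_two_le ((le_div_iff₀ (by positivity)).2 hJ)

/-- Where the jet bump does not vanish the jet is small: `‖J‖² ≤ 2 (n + 1) ρ²`. [folklore] -/
theorem norm_sq_le_of_jetBump_ne_zero {ρ : ℝ} (hρ : 0 < ρ) {J : W × (E' →L[ℝ] W)} (hJ : jetBump ρ J ≠ 0) :
    ‖J‖ ^ 2 ≤ 2 * ((Module.finrank ℝ E' : ℝ) + 1) * ρ ^ 2 := by
  have hq : jetQ J < 2 * ρ ^ 2 := by
    by_contra h; exact hJ (jetBump_eq_zero hρ (not_lt.1 h))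
  have h := norm_sq_le_jetQ J
  nlinarith [jetQ_nonneg J]

/-! ### The radius by compactness -/

omit [FiniteDimensional ℝ E'] in
/-- **The radius by compactness**: for compact `K ⊆ E'` and open `Ω ⊆ E' × 𝒥` containing
`K × {0}`, there is `ρ > 0` with `(y, J) ∈ Ω` whenever `y ∈ K` and `‖J‖ ≤ ρ`. [folklore] -/
theorem exists_radius_of_isCompact {K : Set E'} (hK : IsCompact K) {Ω : Set (E' × (W × (E' →L[ℝ] W)))} (hΩ : IsOpen Ω)
    (hKΩ : ∀ y ∈ K, ((y, 0) : E' × (W × (E' →L[ℝ] W))) ∈ Ω) :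
    ∃ ρ : ℝ, 0 < ρ ∧ ∀ y ∈ K, ∀ J : W × (E' →L[ℝ] W), ‖J‖ ≤ ρ → (y, J) ∈ Ω := by
  have hcont : Continuous fun y : E' ↦ ((y, 0) : E' × (W × (E' →L[ℝ] W))) := continuous_id.prodMk continuous_const
  have hc : IsCompact ((fun y : E' ↦ ((y, 0) : E' × (W × (E' →L[ℝ] W)))) '' K) := hK.image hcont
  have hsub : (fun y : E' ↦ ((y, 0) : E' × (W × (E' →L[ℝ] W)))) '' K ⊆ Ω := by
    rintro _ ⟨y, hy, rfl⟩; exact hKΩ y hy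
  obtain ⟨ρ, hρ, hthick⟩ := hc.exists_cthickening_subset_open hΩ hsub
  refine ⟨ρ, hρ, fun y hy J hJ ↦ hthick ?_⟩
  refine Metric.mem_cthickening_of_dist_le (y, J) (y, (0 : W × (E' →L[ℝ] W))) ρ _ ⟨y, hy, rfl⟩ ?_
  rw [Prod.dist_eq, dist_self, dist_zero_right]
  exact max_le hρ.le hJ

/-! ### The cut-off extension -/

/-- **The cut-off extension** of a coefficient function of point and jet:
`cutoffExt χ ρ G (y, J) = (χ y · jetBump ρ J) • G (y, J)`. [cite: HormanderALPDO1, Thm. 1.4.1] -/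
def cutoffExt (χ : E' → ℝ) (ρ : ℝ) (G : E' × (W × (E' →L[ℝ] W)) → V) (q : E' × (W × (E' →L[ℝ] W))) : V :=
  (χ q.1 * jetBump ρ q.2) • G q

/-- `cutoffExt_apply`: unfolding. [folklore] -/
theorem cutoffExt_apply (χ : E' → ℝ) (ρ : ℝ) (G : E' × (W × (E' →L[ℝ] W)) → V) (q : E' × (W × (E' →L[ℝ] W))) :
    cutoffExt χ ρ G q = (χ q.1 * jetBump ρ q.2) • G q := rfl

/-- **The identity region**: where `χ = 1` and `q(J) ≤ ρ²` the extension is `G`. [folklore] -/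
theorem cutoffExt_eq {χ : E' → ℝ} {ρ : ℝ} (hρ : 0 < ρ) {G : E' × (W × (E' →L[ℝ] W)) → V} {q : E' × (W × (E' →L[ℝ] W))}
    (hχ : χ q.1 = 1) (hJ : jetQ q.2 ≤ ρ ^ 2) : cutoffExt χ ρ G q = G q := by
  rw [cutoffExt_apply, hχ, jetBump_eq_one hρ hJ, one_mul, one_smul]

/-- **Global smoothness of the cut-off extension.** With `χ` smooth supported in `K`, `G` smooth
on the open `Ω`, and radii `2 (n + 1) ρ'² ≤ ρ²` such that `(y, J) ∈ Ω` for `y ∈ K`, `‖J‖ ≤ ρ`, the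
extension `cutoffExt χ ρ' G` is `C^∞` on the whole space. [cite: HormanderALPDO1, Thm. 1.4.1] -/
theorem contDiff_cutoffExt {χ : E' → ℝ} (hχ : ContDiff ℝ ∞ χ) {K : Set E'} (hχK : tsupport χ ⊆ K)
    {Ω : Set (E' × (W × (E' →L[ℝ] W)))} (hΩ : IsOpen Ω) {G : E' × (W × (E' →L[ℝ] W)) → V} (hG : ContDiffOn ℝ ∞ G Ω)
    {ρ ρ' : ℝ} (hρ : 0 < ρ) (hρ' : 0 < ρ') (hρρ : 2 * ((Module.finrank ℝ E' : ℝ) + 1) * ρ' ^ 2 ≤ ρ ^ 2)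
    (hKΩ : ∀ y ∈ K, ∀ J : W × (E' →L[ℝ] W), ‖J‖ ≤ ρ → (y, J) ∈ Ω) :
    ContDiff ℝ ∞ (cutoffExt χ ρ' G) := by
  have hmul : ContDiff ℝ ∞ fun q : E' × (W × (E' →L[ℝ] W)) ↦ χ q.1 * jetBump ρ' q.2 :=
    (hχ.comp contDiff_fst).mul ((contDiff_jetBump ρ').comp contDiff_snd)
  rw [contDiff_iff_contDiffAt]
  intro q
  by_cases hq : q ∈ Ω
  · exact (hmul.contDiffAt).smul (hG.contDiffAt (hΩ.mem_nhds hq))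
  · -- the extension vanishes near `q`
    have hzero : cutoffExt χ ρ' G =ᶠ[𝓝 q] fun _ ↦ 0 := by
      by_cases hy : q.1 ∈ tsupport χ
      · -- `q.1 ∈ K`, hence `‖q.2‖ > ρ`, and the jet bump vanishes near `q`
        have hJ : ρ < ‖q.2‖ := by
          by_contra h
          exact hq (by simpa using hKΩ q.1 (hχK hy) q.2 (not_lt.1 h))
        have hopen : IsOpen {q' : E' × (W × (E' →L[ℝ] W)) | ρ < ‖q'.2‖} := isOpen_lt continuous_const (continuous_snd.norm)
        filter_upwards [hopen.mem_nhds hJ] with q' hq'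
        have hb : jetBump ρ' q'.2 = 0 := by
          by_contra hne
          have h1 := norm_sq_le_of_jetBump_ne_zero hρ' hne
          have hq'' : ρ < ‖q'.2‖ := hq'
          nlinarith [norm_nonneg q'.2]
        rw [cutoffExt_apply, hb, mul_zero, zero_smul]
      · have hopen : IsOpen ((tsupport χ)ᶜ ×ˢ (univ : Set (W × (E' →L[ℝ] W)))) := (isClosed_tsupport χ).isOpen_compl.prod isOpen_univ
        filter_upwards [hopen.mem_nhds (mk_mem_prod hy (mem_univ _))] with q' hq'
        rw [cutoffExt_apply, image_eq_zero_of_notMem_tsupport (mem_prod.1 hq').1, zero_mul, zero_smul]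
    exact (contDiffAt_const (c := (0 : V))).congr_of_eventuallyEq hzero

/-- **Compact support of the cut-off extension**: its support lies in `K × closedBall 0 R`,
`R² = 2 (n + 1) ρ'²`. [folklore] -/
theorem hasCompactSupport_cutoffExt [FiniteDimensional ℝ W] {χ : E' → ℝ} {K : Set E'} (hK : IsCompact K) (hχK : tsupport χ ⊆ K)
    {ρ' : ℝ} (hρ' : 0 < ρ') (G : E' × (W × (E' →L[ℝ] W)) → V) : HasCompactSupport (cutoffExt χ ρ' G) := by
  set R : ℝ := Real.sqrt (2 * ((Module.finrank ℝ E' : ℝ) + 1)) * ρ' with hR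
  refine HasCompactSupport.of_support_subset_isCompact (hK.prod (isCompact_closedBall (0 : W × (E' →L[ℝ] W)) R)) fun q hq ↦ ?_
  rw [Function.mem_support, cutoffExt_apply] at hq
  have hχ0 : χ q.1 ≠ 0 := fun h ↦ hq (by rw [h, zero_mul, zero_smul])
  have hb0 : jetBump ρ' q.2 ≠ 0 := fun h ↦ hq (by rw [h, mul_zero, zero_smul])
  refine mk_mem_prod (hχK (subset_tsupport _ hχ0)) (mem_closedBall_zero_iff.2 ?_)
  have h1 := norm_sq_le_of_jetBump_ne_zero hρ' hb0
  have hR2 : R ^ 2 = 2 * ((Module.finrank ℝ E' : ℝ) + 1) * ρ' ^ 2 := by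
    rw [hR, mul_pow, Real.sq_sqrt (by positivity)]
  have hR0 : 0 ≤ R := by positivity
  nlinarith [norm_nonneg q.2]

end Literature.Analysis.PDE
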